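import Summits.QuantumFields.BalabanUV.T4Continuum.Support.ShellMeasurePlaquetteCubicLocatedPinnedLevels

/-!
# `T4Continuum.ShellMeasurePlaquetteCubicLocatedRowSum` — row S77 file 4: THE ROW SUM OF S77's LOCATED KERNEL MADE
# EXPLICIT BY A COUNT — `Σ_b k c b·e^{δ′ρ(c, b)} ≤ (72(d−1)‖τ‖Lc³·(3d+2)d + 32κLc⁴m)·e^{δ′R}` under ONE displayed pin
# hypothesis («kernel-neighbours are within pin-distance R»); the pinned (P4) binder for OUR action with `M` EXPLICIT
(cell `pub-balaban`, sub-cell `t4`, spine estimate NE7c (node U5b), crew lineage `b2b-balaban-t4-ne7c-formalise-leaf-02` gen 8;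
owner table `LEAVES-NE7c-P1.md` row S77; imports S77 file 3 `ShellMeasurePlaquetteCubicLocatedPinnedLevels` (p227361) ONLY;
[folklore]; 0 sorry, 0 def)

HONEST FRAMING.  Finite four-torus programme, rung (B)+1 only — NOT infinite volume, NOT a mass gap, NOT the Clay
problem, NOT summit progress; (B), `BetaPertHyp`, (B^μ) are not consumed.  NE7c (`T4IndicatorShell.ShellWeightBound`)
is NOT PRINTED and NOT PROVED; «NE7c ⇐ the named binders» (WALL `t4/b2b-balaban-t4-ne7c-p1/WALL-NE7c-P1.md` §2).
ELEMENTARY counting ([folklore]); nothing printed is asserted or cited as a fact; no `def` is minted.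
HONEST DEPENDENCY (cell): continuum YM on T⁴ ⇐ BetaPertH ∧ nine spine estimates (0/9 proved); BetaPertH ⇐ (D1) ∧ (D4)
∧ CAP+tail; G-an2-4 gates asym, D1 and NE2/3/4.

THE POINT.  S77 file 3 (`prop4Hyp_pinned_ord₃_eta_levels`) left ONE input displayed: the row sum
`∀ c, Σ_b k c b·e^{δ′ρ(posOut c, posIn b)} ≤ M` of the η-free located kernel
`k c b = 72(d−1)‖τ‖Lc³·[b.1.1 ∈ nbhdSites c.1.1 c.1.2] + 8κLc⁴·#{p ∈ Pl : c ∈ bonds (bd p) ∧ b ∈ bonds (bd p)}`.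
The kernel is FINITE-RANGE, so the row sum is a COUNT times `e^{δ′R}` once kernel-neighbours are within pin-distance `R`:
* §1 `card_nbhdSites_le` (`#nbhdSites y κ ≤ 3d + 2`), `card_filter_nbhd_le` (`#{b ∈ Λ : b.1.1 ∈ nbhdSites c} ≤ (3d+2)·d`),
  `card_bonds_le` (`#bonds q ≤ 4`), `sum_card_filter_le` (`Σ_b #{p ∈ Pl : c, b ∈ ∂p} ≤ 4m` under the incidence bound `m`);
* §2 **`rowSum_kernel_le`**: `Σ_b k c b·e^{δ′ρ(posOut c, posIn b)} ≤ (72(d−1)‖τ‖Lc³·((3d+2)d) + 8κLc⁴·(4m))·e^{δ′R}` for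
  `δ′ ≥ 0` and the pin hypothesis `hR : b.1.1 ∈ nbhdSites c ∨ (∃ p ∈ Pl, c, b ∈ ∂p) → ρ (posOut c) (posIn b) ≤ R`;
* §3 **`prop4Hyp_pinned_ord₃_eta_levels_explicit`**: S77 file 3 with `M := (72(d−1)‖τ‖Lc³·((3d+2)d) + 32κLc⁴m)·e^{δ′R}` —
  the pinned (P4) binder for OUR η-scaled action at the live levels with an EXPLICIT, η-FREE, VOLUME-FREE constant; the
  only pin inputs left are GEOMETRIC (`ϖ ≥ 0` one-sided Lipschitz for `ρ`, `δ′ ≥ 0`, neighbours within `R`).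
NOT HERE: the identification of `posIn`, `posOut`, `ρ`, `ϖ`, `R` with Bałaban's blocks and distances ([dict]∕node O; for
unit-lattice positions `R` is an absolute constant); no estimate of Bałaban's at a live level is discharged.
-/

noncomputable section

open scoped BigOperators

namespace Summit.QuantumFields.BalabanUV.T4Continuum.ShellMeasurePlaquetteCubicLocatedRowSum

open Literature.MathematicalPhysics.QuantumFieldTheory.Balaban1983to89
open B7Prop1Explicit (e U1)
open B8Ineq132 (covDerivFwd)
open B11Prop6Scheme (Prop4Hyp)
open ShellMeasureWilsonGradientTail (plaqWord bonds)
open ShellMeasurePlaquetteTwist (plaqFunSym)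
open ShellMeasureLocalGradientTailJet (ord₃)
open Summit.QuantumFields.BalabanUV.T4Continuum.ShellMeasureCommutatorVariation (plaqStar)
open Summit.QuantumFields.BalabanUV.T4Continuum.ShellMeasureCommutatorGradientLocal (baseSites nbhdSites)
open Summit.QuantumFields.BalabanUV.T4Continuum.ShellMeasureCommutatorLocGrad (ext)
open Summit.QuantumFields.BalabanUV.T4Continuum.ShellMeasureLocalGradientTail (locGrad)
open Summit.QuantumFields.BalabanUV.T4Continuum.ShellMeasureMultiGridNorms (WSup)
open Summit.QuantumFields.BalabanUV.T4Continuum.ShellMeasureMultiGridNormsMax (WMax)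
open Summit.QuantumFields.BalabanUV.T4Continuum.ShellMeasurePinnedNorm (pinW)
open Summit.QuantumFields.BalabanUV.T4Continuum.ShellMeasureWilsonRemainderLevels (etaScale)
open Summit.QuantumFields.BalabanUV.T4Continuum.ShellMeasurePlaquetteCubicLocated (sum_filter_sum_eq_sum_card)
open Summit.QuantumFields.BalabanUV.T4Continuum.ShellMeasurePlaquetteCubicLocatedPinnedLevels (prop4Hyp_pinned_ord₃_eta_levels)

export B7Prop1Explicit (Site)

/-! ## §1 The counts -/

section Counts

variable {d : ℕ}

/-- `#nbhdSites y κ ≤ 3d + 2`. [folklore] -/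
theorem card_nbhdSites_le (y : Site d) (κ : Fin d) : (nbhdSites y κ).card ≤ 3 * d + 2 := by
  unfold nbhdSites
  have h3 : ∀ ν : Fin d, (({y + e ν, y - e ν, y - e ν + e κ} : Finset (Site d))).card ≤ 3 := fun ν =>
    Finset.card_le_three
  have hU : (Finset.univ.biUnion fun ν : Fin d => ({y + e ν, y - e ν, y - e ν + e κ} : Finset (Site d))).card ≤ 3 * d :=
    calc _ ≤ ∑ ν : Fin d, (({y + e ν, y - e ν, y - e ν + e κ} : Finset (Site d))).card := Finset.card_biUnion_le
      _ ≤ ∑ _ν : Fin d, 3 := Finset.sum_le_sum fun ν _ => h3 ν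
      _ = 3 * d := by simp [mul_comm]
  calc _ ≤ (insert (y + e κ) (Finset.univ.biUnion fun ν : Fin d =>
          ({y + e ν, y - e ν, y - e ν + e κ} : Finset (Site d)))).card + 1 := Finset.card_insert_le _ _
    _ ≤ (Finset.univ.biUnion fun ν : Fin d => ({y + e ν, y - e ν, y - e ν + e κ} : Finset (Site d))).card + 1 + 1 :=
        Nat.add_le_add_right (Finset.card_insert_le _ _) 1
    _ ≤ 3 * d + 2 := by omega

variable (Λ : Finset (Site d × Fin d))

/-- `#{b ∈ Λ : b.1.1 ∈ nbhdSites c} ≤ (3d+2)·d` (a bond is a site and a direction). [folklore] -/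
theorem card_filter_nbhd_le (c : ↥Λ) :
    (Finset.univ.filter (fun b : ↥Λ => b.1.1 ∈ nbhdSites c.1.1 c.1.2)).card ≤ (3 * d + 2) * d := by
  have hmaps : Set.MapsTo (fun b : ↥Λ => ((b : Site d × Fin d).1, (b : Site d × Fin d).2))
      ↑(Finset.univ.filter (fun b : ↥Λ => b.1.1 ∈ nbhdSites c.1.1 c.1.2))
      ↑(nbhdSites c.1.1 c.1.2 ×ˢ (Finset.univ : Finset (Fin d))) := by
    intro b hb
    simp only [Finset.coe_filter, Finset.mem_univ, true_and, Set.mem_setOf_eq] at hb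
    simp [hb]
  have hinj : Set.InjOn (fun b : ↥Λ => ((b : Site d × Fin d).1, (b : Site d × Fin d).2))
      ↑(Finset.univ.filter (fun b : ↥Λ => b.1.1 ∈ nbhdSites c.1.1 c.1.2)) := by
    intro b _ b' _ h
    exact Subtype.ext (Prod.ext (congrArg Prod.fst h) (congrArg Prod.snd h))
  calc _ ≤ (nbhdSites c.1.1 c.1.2 ×ˢ (Finset.univ : Finset (Fin d))).card := Finset.card_le_card_of_injOn _ hmaps hinj
    _ = (nbhdSites c.1.1 c.1.2).card * d := by rw [Finset.card_product, Finset.card_univ, Fintype.card_fin]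
    _ ≤ (3 * d + 2) * d := Nat.mul_le_mul_right d (card_nbhdSites_le c.1.1 c.1.2)

/-- A boundary has at most four bonds. [folklore] -/
theorem card_bonds_le (q : Fin 4 → ↥Λ × Bool) : (bonds q).card ≤ 4 := by
  unfold bonds
  calc _ ≤ (Finset.univ : Finset (Fin 4)).card := Finset.card_image_le
    _ = 4 := by simp

variable (Pl : Finset (Fin d × Fin d × Site d)) (bd : Fin d × Fin d × Site d → (Fin 4 → ↥Λ × Bool))

/-- `Σ_b #{p ∈ Pl : c ∈ ∂p ∧ b ∈ ∂p} ≤ 4m` under the incidence bound `#{p ∈ Pl : c ∈ ∂p} ≤ m`. [folklore] -/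
theorem sum_card_filter_le {m : ℕ} (hm : ∀ b : ↥Λ, (Pl.filter (fun p => b ∈ bonds (bd p))).card ≤ m) (c : ↥Λ) :
    ∑ b : ↥Λ, ((Pl.filter (fun p => c ∈ bonds (bd p) ∧ b ∈ bonds (bd p))).card : ℝ) ≤ 4 * m := by
  have h := (sum_filter_sum_eq_sum_card Pl (fun p => bonds (bd p)) c (fun _ => (1 : ℝ))).symm
  simp only [mul_one] at h
  rw [h]
  calc ∑ p ∈ Pl.filter (fun p => c ∈ bonds (bd p)), ∑ _b ∈ bonds (bd p), (1 : ℝ)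
      ≤ ∑ _p ∈ Pl.filter (fun p => c ∈ bonds (bd p)), (4 : ℝ) := by
        refine Finset.sum_le_sum fun p _ => ?_
        rw [Finset.sum_const, nsmul_eq_mul, mul_one]
        exact_mod_cast card_bonds_le Λ (bd p)
    _ = ((Pl.filter (fun p => c ∈ bonds (bd p))).card : ℝ) * 4 := by rw [Finset.sum_const, nsmul_eq_mul]
    _ ≤ (m : ℝ) * 4 := by
        have : ((Pl.filter (fun p => c ∈ bonds (bd p))).card : ℝ) ≤ m := by exact_mod_cast hm c
        gcongr
    _ = 4 * m := by ring

end Counts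

/-! ## §2 The row sum of S77's kernel -/

section RowSum

variable {d : ℕ} (Λ : Finset (Site d × Fin d)) (Pl : Finset (Fin d × Fin d × Site d))
  (bd : Fin d × Fin d × Site d → (Fin 4 → ↥Λ × Bool))

/-- **THE ROW SUM OF THE LOCATED KERNEL IS A COUNT.**  For nonnegative `K₁`, `K₂`, `δ′ ≥ 0`, the incidence bound
`#{p ∈ Pl : c ∈ ∂p} ≤ m` and the PIN HYPOTHESIS «kernel-neighbours of `c` are within pin-distance `R`»:
`Σ_b (K₁·[b.1.1 ∈ nbhdSites c] + K₂·#{p ∈ Pl : c, b ∈ ∂p})·e^{δ′ρ(posOut c, posIn b)} ≤ (K₁·((3d+2)d) + K₂·(4m))·e^{δ′R}`.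
[folklore] -/
theorem rowSum_kernel_le {S : Type*} (ρ : S → S → ℝ) (posIn posOut : ↥Λ → S) {δ' R K₁ K₂ : ℝ} (hδ' : 0 ≤ δ')
    (hK₁ : 0 ≤ K₁) (hK₂ : 0 ≤ K₂) {m : ℕ} (hm : ∀ b : ↥Λ, (Pl.filter (fun p => b ∈ bonds (bd p))).card ≤ m) (c : ↥Λ)
    (hR : ∀ b : ↥Λ, (b.1.1 ∈ nbhdSites c.1.1 c.1.2 ∨ ∃ p ∈ Pl, c ∈ bonds (bd p) ∧ b ∈ bonds (bd p)) →
      ρ (posOut c) (posIn b) ≤ R) :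
    ∑ b : ↥Λ, (K₁ * (if b.1.1 ∈ nbhdSites c.1.1 c.1.2 then 1 else 0)
        + K₂ * ((Pl.filter (fun p => c ∈ bonds (bd p) ∧ b ∈ bonds (bd p))).card : ℝ))
        * Real.exp (δ' * ρ (posOut c) (posIn b)) ≤
      (K₁ * ((3 * d + 2) * d : ℕ) + K₂ * (4 * m)) * Real.exp (δ' * R) := by
  -- each term: either the kernel vanishes or the pin-distance is ≤ R
  have hterm : ∀ b : ↥Λ,
      (K₁ * (if b.1.1 ∈ nbhdSites c.1.1 c.1.2 then 1 else 0)
        + K₂ * ((Pl.filter (fun p => c ∈ bonds (bd p) ∧ b ∈ bonds (bd p))).card : ℝ))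
        * Real.exp (δ' * ρ (posOut c) (posIn b)) ≤
      (K₁ * (if b.1.1 ∈ nbhdSites c.1.1 c.1.2 then 1 else 0)
        + K₂ * ((Pl.filter (fun p => c ∈ bonds (bd p) ∧ b ∈ bonds (bd p))).card : ℝ)) * Real.exp (δ' * R) := by
    intro b
    have hk0 : 0 ≤ K₁ * (if b.1.1 ∈ nbhdSites c.1.1 c.1.2 then (1 : ℝ) else 0)
        + K₂ * ((Pl.filter (fun p => c ∈ bonds (bd p) ∧ b ∈ bonds (bd p))).card : ℝ) := by
      have : 0 ≤ (if b.1.1 ∈ nbhdSites c.1.1 c.1.2 then (1 : ℝ) else 0) := by split_ifs <;> norm_num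
      positivity
    by_cases hb : b.1.1 ∈ nbhdSites c.1.1 c.1.2 ∨ ∃ p ∈ Pl, c ∈ bonds (bd p) ∧ b ∈ bonds (bd p)
    · exact mul_le_mul_of_nonneg_left (Real.exp_le_exp.2 (mul_le_mul_of_nonneg_left (hR b hb) hδ')) hk0
    · -- the kernel vanishes
      obtain ⟨hb1, hb2⟩ := not_or.1 hb
      have h1 : (if b.1.1 ∈ nbhdSites c.1.1 c.1.2 then (1 : ℝ) else 0) = 0 := if_neg hb1
      have h2 : (Pl.filter (fun p => c ∈ bonds (bd p) ∧ b ∈ bonds (bd p))).card = 0 := by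
        rw [Finset.card_eq_zero, Finset.filter_eq_empty_iff]
        intro p hp hpb
        exact hb2 ⟨p, hp, hpb.1, hpb.2⟩
      rw [h1, h2]
      simp
  refine (Finset.sum_le_sum fun b _ => hterm b).trans ?_
  rw [← Finset.sum_mul]
  refine mul_le_mul_of_nonneg_right ?_ (Real.exp_pos _).le
  rw [Finset.sum_add_distrib, ← Finset.mul_sum, ← Finset.mul_sum]
  refine add_le_add (mul_le_mul_of_nonneg_left ?_ hK₁) (mul_le_mul_of_nonneg_left (sum_card_filter_le Λ Pl bd hm c) hK₂)
  rw [Finset.sum_boole]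
  exact_mod_cast card_filter_nbhd_le Λ c

end RowSum

/-! ## §3 The pinned (P4) binder for OUR action with `M` explicit -/

section Explicit

variable {d : ℕ} {𝔸 : Type*} [NormedRing 𝔸] [NormOneClass 𝔸] [NormedAlgebra ℂ 𝔸] [CompleteSpace 𝔸]
  (Λ : Finset (Site d × Fin d)) (Pl : Finset (Fin d × Fin d × Site d)) (τ : 𝔸 →L[ℂ] ℂ)
  {U₀ : Site d → Fin d → 𝔸ˣ} (h₀ : ∀ y κ, U₀ y κ ∈ U1 𝔸) (bd : Fin d × Fin d × Site d → (Fin 4 → ↥Λ × Bool))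
  (wt : ↥Λ → ℝ) [hwt : Fact (∀ b, 0 < wt b)] {I : Type*} [Fintype I] (wd : I → ℝ) [hwd : Fact (∀ i, 0 < wd i)]
  (Dv : (↥Λ → 𝔸) →L[ℂ] (I → 𝔸)) (Wf Wd : ↥Λ → ℝ) (W : Fin d × Fin d × Site d → ℝ)
include h₀

/-- **THE PINNED (P4) BINDER AT THE LIVE LEVELS FOR OUR η-SCALED ACTION, CONSTANT EXPLICIT.**  S77 file 3's
`prop4Hyp_pinned_ord₃_eta_levels` with its displayed row sum DISCHARGED by §2:
`M = (72(d−1)‖τ‖Lc³·((3d+2)d) + 8κLc⁴·(4m))·e^{δ′R}`, `κ = ‖τ‖(248∕3·ε₀ + 40∕3·ε)` — η-FREE, VOLUME-FREE — under the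
geometric hypotheses of f5d-c, the pin (`ϖ ≥ 0` one-sided Lipschitz for `ρ`, `δ′ ≥ 0`) and ONE displayed pin input:
kernel-neighbours (`b.1.1 ∈ nbhdSites c` or `c, b ∈ ∂p` for some `p ∈ Pl`) are within pin-distance `R` of `c`
(and `1 ≤ d`, for the sign of the constant).  [Balaban1985Variational] (98) TYPE, located and pinned; nothing printed
is asserted. [folklore] -/
theorem prop4Hyp_pinned_ord₃_eta_levels_explicit {η : ℝ} (hη : 0 < η) (htr : ∀ P Q : 𝔸, τ (P * Q) = τ (Q * P))
    (hincr : ∀ p ∈ Pl, p.1 < p.2.1) (hst : ∀ b : ↥Λ, plaqStar b.1.1 b.1.2 ⊆ Pl)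
    (hbd : ∀ p ∈ Pl, ((bd p 0).1 : Site d × Fin d) = (p.2.2, p.1) ∧ ((bd p 1).1 : Site d × Fin d) = (p.2.2 + e p.1, p.2.1)
      ∧ ((bd p 2).1 : Site d × Fin d) = (p.2.2 + e p.2.1, p.1) ∧ ((bd p 3).1 : Site d × Fin d) = (p.2.2, p.2.1))
    (hor : ∀ p ∈ Pl, (bd p 0).2 = true ∧ (bd p 1).2 = true ∧ (bd p 2).2 = false ∧ (bd p 3).2 = false)
    {Lc : ℝ} (hLc : 1 ≤ Lc) (hWd0 : ∀ b, 0 < Wd b)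
    (hWf : ∀ b b' : ↥Λ, b'.1.1 ∈ nbhdSites b.1.1 b.1.2 → Wf b ≤ wt b')
    (hcf : ∀ b, wt b ≤ Lc * Wf b) (hcd : ∀ b, wt b ≤ Lc * Wd b)
    (hDv : ∀ (A : ↥Λ → 𝔸) (b : ↥Λ) (x : Site d) (κ' τ' : Fin d), x ∈ baseSites b.1.1 →
      Wd b ^ 2 * ‖covDerivFwd η U₀ κ' (fun z => ext Λ A z τ') x‖ ≤ ‖(WSup.toPiL wd 2).symm (Dv A)‖)
    {ε ε₀ : ℝ} (hε : 0 < ε) (hε₀ : 0 ≤ ε₀) (hε4 : 4 * ε ≤ 1) (hηW : ∀ p ∈ Pl, η ≤ W p)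
    (hWw : ∀ p ∈ Pl, ∀ b ∈ bonds (bd p), W p ≤ wt b) (hwW : ∀ p ∈ Pl, ∀ b ∈ bonds (bd p), wt b ≤ Lc * W p)
    (hreg : ∀ p ∈ Pl, ‖(plaqWord (fun b : ↥Λ => U₀ b.1.1 b.1.2) (bd p) (0 : ↥Λ → 𝔸) : 𝔸) - 1‖ ≤ ε₀ * (η / W p) ^ 2)
    {m : ℕ} (hm : ∀ b : ↥Λ, (Pl.filter (fun p => b ∈ bonds (bd p))).card ≤ m) (hd1 : 1 ≤ d)
    {S : Type*} (ρ : S → S → ℝ) (posIn posOut : ↥Λ → S) (ϖ : S → ℝ) {δ' R : ℝ} (hδ' : 0 ≤ δ')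
    (hϖ0 : ∀ x, 0 ≤ ϖ x) (hϖ : ∀ x y, ϖ x ≤ ϖ y + ρ x y)
    (hR : ∀ c b : ↥Λ, (b.1.1 ∈ nbhdSites c.1.1 c.1.2 ∨ ∃ p ∈ Pl, c ∈ bonds (bd p) ∧ b ∈ bonds (bd p)) →
      ρ (posOut c) (posIn b) ≤ R) :
    Prop4Hyp (fun Y : WMax (fun b => wt b * pinW δ' (ϖ ∘ posIn) b) wd Dv =>
        ((WSup.toPiL (fun c => wt c ^ 3 * pinW δ' (ϖ ∘ posOut) c) 1).symm
          (locGrad (etaScale η (fun A : ↥Λ → 𝔸 =>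
              ∑ p ∈ Pl, ord₃ (plaqFunSym τ (fun b : ↥Λ => U₀ b.1.1 b.1.2) (bd p)) A))
            (WMax.toPiL (fun b => wt b * pinW δ' (ϖ ∘ posIn) b) wd Dv Y)) :
          WSup (fun c => wt c ^ 3 * pinW δ' (ϖ ∘ posOut) c) 1 (𝔸 →L[ℂ] ℂ)))
      ((72 * ((d : ℝ) - 1) * ‖τ‖ * Lc ^ 3 * ((3 * d + 2) * d : ℕ)
          + 8 * (‖τ‖ * (248 / 3 * ε₀ + 40 / 3 * ε)) * Lc ^ 4 * (4 * m)) * Real.exp (δ' * R))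
      (ε / 2) := by
  have hd : 0 ≤ (d : ℝ) - 1 := by
    have : (1 : ℝ) ≤ d := by exact_mod_cast hd1
    linarith
  have hLc0 : 0 ≤ Lc := zero_le_one.trans hLc
  have hK₁ : 0 ≤ 72 * ((d : ℝ) - 1) * ‖τ‖ * Lc ^ 3 := by positivity
  have hK₂ : 0 ≤ 8 * (‖τ‖ * (248 / 3 * ε₀ + 40 / 3 * ε)) * Lc ^ 4 := by positivity
  have hM0 : 0 ≤ (72 * ((d : ℝ) - 1) * ‖τ‖ * Lc ^ 3 * ((3 * d + 2) * d : ℕ)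
      + 8 * (‖τ‖ * (248 / 3 * ε₀ + 40 / 3 * ε)) * Lc ^ 4 * (4 * m)) * Real.exp (δ' * R) := by positivity
  exact prop4Hyp_pinned_ord₃_eta_levels Λ Pl τ h₀ bd wt wd Dv Wf Wd W hη htr hincr hst hbd hor hLc hWd0 hWf hcf hcd hDv
    hε hε₀ hε4 hηW hWw hwW hreg ρ posIn posOut ϖ hδ' hϖ0 hϖ hM0
    (fun c => rowSum_kernel_le Λ Pl bd ρ posIn posOut hδ' hK₁ hK₂ hm c (hR c))

end Explicit

end Summit.QuantumFields.BalabanUV.T4Continuum.ShellMeasurePlaquetteCubicLocatedRowSum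

end
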